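import Literature.AlgebraicGeometry.Motives.AbelianVarietyPermutationPowerHom
import HarnessLib

/-!
# The `ℓ`-adic character of a permutation power is the number of fixed points:
# `χ_ℓ(g) = Tr(ρ(g) | T_ℓ A^S) = |S^g| · 2 dim A`, and Burnside's count `dim B_H(A^S) = |H\S| · dim A`

Let `A` be an abelian variety over a field `K`, `S` a finite `G`-set and `X = A^S` a permutation power (a bicone `b` over
`(A)_{s ∈ S}` with `Σ_s π_s ≫ ι_s = 𝟙`, and `ρ : G → End X` with `ι_s ≫ ρ(g) = ι_{g s}`, as in
`Motives/AbelianVarietyPermutationPowerHom`).  For a prime `ℓ` invertible in `K` the Tate module `T_ℓ X ≅ ⊕_s T_ℓ A` is the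
representation `T_ℓ A ⊗ ℤ_ℓ[S]`, so the `ℓ`-adic character of the action is `2 dim A` times the PERMUTATION CHARACTER of `S`
(Serre Ex. 2.2: "`χ_X(s)` is the number of elements of `X` fixed by `s`"):

  **`Tr(ρ(g) | T_ℓ X) = |S^g| · 2 dim A`**   (`trace_tateModuleMap_permAction_eq`; `S^g = fixedBy S g`),

proved from the block formula **`Tr(f | T_ℓ A^S) = Σ_s Tr(ι_s ≫ f ≫ π_s | T_ℓ A)`** (§1, `Tr(AB) = Tr(BA)`) and the permutation
matrix `ι_s ≫ ρ(g) ≫ π_s = δ_{g s, s}`.  Consequences (§3; the auxiliary prime is chosen inside the proofs, the statements are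
prime-free):

* **`dim A^S = |S| · dim A`** (`dim_permPower_eq_card_mul`, `f = 𝟙`);
* **Burnside's count for the Kani–Rosen factor of the trivial representation**: with `N_G = Σ_g ρ(g)` and `B_G = Im N_G`
  (`|G| · 2 dim B_G = Σ_g χ_ℓ(g)`, `Motives/AbelianVarietyTateModuleTraceDimensionFormula`) and Burnside's lemma
  `Σ_g |S^g| = |G\S| · |G|` (Mathlib `MulAction.sum_card_fixedBy_eq_card_orbits_mul_card_group`; Serre Ex. 2.6 (a):
  `⟨χ_S, 1⟩ =` number of orbits),
  **`dim B_G(A^S) = |G\S| · dim A`** (`dim_image_normG_permAction_eq`) and, for a finite subgroup `H`,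
  **`dim B_H(A^S) = |H\S| · dim A`** (`dim_image_norm_permAction_eq`): `B_H` is the "orbit-diagonal" copy of `A^{S/H}`;
  in particular `dim B_G = dim A` for a TRANSITIVE `G`-set (`dim_image_normG_permAction_eq_dim_of_isPretransitive`), e.g. for
  the regular power `A^G` or a coset power `A^{G/L}`;
* §4 the TWISTED (monomial) actions `ι_s ≫ ρ(g) = α(g) ≫ ι_{g s}` by a second action `α : G → End A` (`A ⊗ ℤ[S]` with `G` acting
  diagonally; e.g. `μ_n ≀ 𝔖_n` on `E^n`): **`Tr(ρ(g) | T_ℓ X) = |S^g| · Tr(α(g) | T_ℓ A)`** and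
  **`|H| · 2 dim B_H = Σ_{h ∈ H} |S^h| · χ_ℓ^α(h)`** (`= |H| ⟨χ_S χ_α, 1⟩_H`).

Everything is a theorem (no definitions); `χ_ℓ` lives in `ℤ_ℓ` for one auxiliary prime `ℓ`.

## References

* [SerreLinearRepresentations1977] J.-P. Serre, *Linear Representations of Finite Groups*, GTM 42 (1977): §2.3 Ex. 2.2 ("show that
  `χ_X(s)` is the number of elements of `X` fixed by `s`"), Ex. 2.6 (a) ("`(χ|1) = c`", the number of orbits), §3.3 Ex. 2, Ex. 7.2
  (`χ_{G/H} = Ind_H^G 1`).  Held: `book:serre1977-linear-representations-finite-groups`, pp. 16, 20, 30, 52 read.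
* [JordanEtAl2018] B. W. Jordan et al., *Abelian varieties isogenous to a power of an elliptic curve*, Compos. Math. 154 (2018),
  §4.1 (power objects `𝓗𝓞𝓜_R(M, E)`), Prop. 4.3 (`dim 𝓗𝓞𝓜_R(M, E) = rk M · dim E`), Thm. 4.4 (g) (`T_ℓ 𝓗𝓞𝓜_R(M, E) ≅ Hom_R(M, T_ℓ E)`).
* [LangeRodriguez2022] H. Lange, R. E. Rodríguez, *Decomposition of Jacobians by Prym Varieties*, LNM 2310 (2022), §2.9.1
  Prop. 2.9.3 (PDF p. 46: `dim B_W` from `⟨ρ, W⟩`), Cor. 3.5.10.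
* [KaniRosen1989] E. Kani, M. Rosen, *Idempotent relations and factors of Jacobians*, Math. Ann. 284 (1989), §3 Thm. B.
* [DokchitserEtAl2022] V. Dokchitser, H. Green, A. Konstantinou, A. Morgan, *Parity of ranks of Jacobians of curves*,
  arXiv:2211.06357, §3 (additive functor lemma: `V_ℓ(B_H) ≅ V_ℓ(X)^H`).
* [MumfordAV1970] D. Mumford, *Abelian Varieties* (1970), §19 Thm. 3 (p. 176: `T_ℓ` additive), Thm. 4 (p. 180).
-/

noncomputable section

open CategoryTheory CategoryTheory.Limits
open Literature.NumberTheory.DiophantineGeometry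

universe u

namespace Literature.AlgebraicGeometry.Motives

namespace AbelianVariety

variable {K : Type u} [Field K]

/-! ## §1 Traces on a power: `Tr(f | T_ℓ A^S) = Σ_s Tr(ι_s ≫ f ≫ π_s | T_ℓ A)` -/

section Blocks

variable (ℓ : ℕ) [Fact ℓ.Prime] {A : AbelianVariety K} {S : Type} [Fintype S] (b : Bicone (fun _ : S ↦ A))

/-- **The `ℓ`-adic trace of an endomorphism of a power is the sum of the traces of its diagonal blocks**:
`Tr(T_ℓ f | T_ℓ A^S) = Σ_s Tr(T_ℓ(ι_s ≫ f ≫ π_s) | T_ℓ A)` (`f = Σ_s π_s ≫ ι_s ≫ f`, additivity of `T_ℓ`, and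
`Tr(T_ℓ(ι_s f) ∘ T_ℓ π_s) = Tr(T_ℓ π_s ∘ T_ℓ(ι_s f))`; `ℓ` invertible in `K` so that the Tate modules are free of finite rank).
[cite: MumfordAV1970, §19 Thm. 3 (p. 176) and Thm. 4 (p. 180)] [cite: JordanEtAl2018, Thm. 4.4 (g) (`T_ℓ 𝓗𝓞𝓜_R(M, E) ≅ Hom_R(M, T_ℓ E)`)] -/
theorem trace_tateModuleMap_permPower_eq_sum (hb : ∑ s, b.π s ≫ b.ι s = 𝟙 b.pt) (hℓ : (ℓ : K) ≠ 0)
    (f : b.pt ⟶ b.pt) :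
    LinearMap.trace ℤ_[ℓ] (b.pt.tateModule ℓ) (tateModuleMap ℓ f) =
      ∑ s, LinearMap.trace ℤ_[ℓ] (A.tateModule ℓ) (tateModuleMap ℓ (b.ι s ≫ f ≫ b.π s)) := by
  haveI := b.pt.module_free_tateModule_holds ℓ hℓ
  haveI := module_finite_tateModule_of_cast_ne_zero b.pt ℓ hℓ
  haveI := A.module_free_tateModule_holds ℓ hℓ
  haveI := module_finite_tateModule_of_cast_ne_zero A ℓ hℓ
  conv_lhs => rw [eq_sum_π_comp_ι_comp b hb f, tateModuleMap_sum, map_sum]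
  refine Finset.sum_congr rfl fun s _ ↦ ?_
  rw [tateModuleMap_comp, LinearMap.trace_comp_comm', ← tateModuleMap_comp, Category.assoc]

/-- **`dim A^S = |S| · dim A`** for a power `A^S` (a bicone with `Σ_s π_s ≫ ι_s = 𝟙`): `Tr(𝟙 | T_ℓ A^S) = 2 dim A^S` and, block by
block, `= Σ_s Tr(T_ℓ(ι_s ≫ π_s)) = |S| · 2 dim A` for an auxiliary prime `ℓ` invertible in `K`.
[cite: JordanEtAl2018, §4.2 Prop. 4.3 (`dim 𝓗𝓞𝓜_R(M, E) = rk M · dim E`)] [cite: MumfordAV1970, §19 Thm. 4 (p. 180)] -/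
theorem dim_permPower_eq_card_mul (hb : ∑ s, b.π s ≫ b.ι s = 𝟙 b.pt) : b.pt.dim = Fintype.card S * A.dim := by
  obtain ⟨ℓ', hℓ'p, hℓ'⟩ := exists_prime_natCast_ne_zero (K := K)
  haveI : Fact ℓ'.Prime := ⟨hℓ'p⟩
  have h := trace_tateModuleMap_permPower_eq_sum ℓ' b hb hℓ' (𝟙 b.pt)
  simp_rw [Category.id_comp, bicone_ι_π_self] at h
  rw [trace_tateModuleMap_id_eq_two_mul_dim ℓ' b.pt hℓ'] at h
  have h' : ((2 * b.pt.dim : ℕ) : ℤ_[ℓ']) = ((Fintype.card S * (2 * A.dim) : ℕ) : ℤ_[ℓ']) := by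
    rw [h, Finset.sum_congr rfl fun s _ ↦ trace_tateModuleMap_id_eq_two_mul_dim ℓ' A hℓ', Finset.sum_const,
      Finset.card_univ, nsmul_eq_mul]
    push_cast
    ring
  have h'' := Nat.cast_injective (R := ℤ_[ℓ']) h'
  refine Nat.eq_of_mul_eq_mul_left (show 0 < 2 by norm_num) ?_
  rw [h'']
  ring

end Blocks

/-! ## §2 The permutation character: `Tr(ρ(g) | T_ℓ A^S) = |S^g| · 2 dim A` -/

section Character

variable (ℓ : ℕ) [Fact ℓ.Prime] {A : AbelianVariety K} {S : Type} [Fintype S] (b : Bicone (fun _ : S ↦ A))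
  {G : Type} [Group G] [MulAction G S] (ρ : G →* End b.pt)

/-- **The `ℓ`-adic character of a permutation power is the number of fixed points: `Tr(ρ(g) | T_ℓ A^S) = |S^g| · 2 dim A`**
(`S^g = {s | g s = s}`; `ℓ` invertible in `K`): the diagonal blocks of the permutation matrix are `ι_s ≫ ρ(g) ≫ π_s = δ_{g s, s}`,
and `Tr(𝟙 | T_ℓ A) = 2 dim A`.  This is Serre's Ex. 2.2 for the representation `T_ℓ A^S = T_ℓ A ⊗ ℤ_ℓ[S]`.
[cite: SerreLinearRepresentations1977, §2.3 Ex. 2.2 (`χ_X(s)` = number of fixed points)] [cite: MumfordAV1970, §19 Thm. 4 (p. 180)]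
[cite: JordanEtAl2018, Thm. 4.4 (g)] -/
theorem trace_tateModuleMap_permAction_eq (hb : ∑ s, b.π s ≫ b.ι s = 𝟙 b.pt)
    (hρ : ∀ (g : G) (s : S), b.ι s ≫ End.asHom (ρ g) = b.ι (g • s)) (hℓ : (ℓ : K) ≠ 0) (g : G) :
    LinearMap.trace ℤ_[ℓ] (b.pt.tateModule ℓ) (tateModuleMap ℓ (End.asHom (ρ g))) =
      (((MulAction.fixedBy S g).ncard * (2 * A.dim) : ℕ) : ℤ_[ℓ]) := by
  classical
  rw [trace_tateModuleMap_permPower_eq_sum ℓ b hb hℓ]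
  have hdiag : ∀ s : S, LinearMap.trace ℤ_[ℓ] (A.tateModule ℓ) (tateModuleMap ℓ (b.ι s ≫ End.asHom (ρ g) ≫ b.π s)) =
      if g • s = s then (((2 * A.dim : ℕ) : ℤ_[ℓ])) else 0 := fun s ↦ by
    rw [ι_comp_asHom_permAction_comp_π b ρ hρ g s s]
    split_ifs
    · exact trace_tateModuleMap_id_eq_two_mul_dim ℓ A hℓ
    · rw [tateModuleMap_zero, map_zero]
  have hcard : (Finset.univ.filter fun s : S ↦ g • s = s).card = (MulAction.fixedBy S g).ncard := by
    rw [← Set.ncard_coe_finset]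
    exact congrArg Set.ncard (Set.ext fun s ↦ by simp)
  rw [Finset.sum_congr rfl fun s _ ↦ hdiag s, Finset.sum_ite, Finset.sum_const_zero, add_zero, Finset.sum_const,
    nsmul_eq_mul, hcard, ← Nat.cast_mul]

/-- An element WITHOUT fixed points has `ℓ`-adic trace `0` on the permutation power (e.g. every `g ≠ 1` for a FREE action:
the character is "of regular type", cf. `Motives/AbelianVarietyCharacterSupportRanks`).
[cite: SerreLinearRepresentations1977, §2.3 Ex. 2.2] -/
theorem trace_tateModuleMap_permAction_eq_zero_of_fixedBy_eq_empty (hb : ∑ s, b.π s ≫ b.ι s = 𝟙 b.pt)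
    (hρ : ∀ (g : G) (s : S), b.ι s ≫ End.asHom (ρ g) = b.ι (g • s)) (hℓ : (ℓ : K) ≠ 0) {g : G}
    (hg : MulAction.fixedBy S g = ∅) :
    LinearMap.trace ℤ_[ℓ] (b.pt.tateModule ℓ) (tateModuleMap ℓ (End.asHom (ρ g))) = 0 := by
  rw [trace_tateModuleMap_permAction_eq ℓ b ρ hb hρ hℓ g, hg, Set.ncard_empty, zero_mul, Nat.cast_zero]

/-- **`Σ_{g ∈ G} Tr(ρ(g) | T_ℓ A^S) = |G\S| · |G| · 2 dim A`** (Burnside's lemma `Σ_g |S^g| = |G\S| · |G|`; Serre Ex. 2.6 (a):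
`⟨χ_S, 1⟩` is the number of orbits). [cite: SerreLinearRepresentations1977, §2.3 Ex. 2.6 (a)] [cite: MumfordAV1970, §19 Thm. 4 (p. 180)] -/
theorem sum_trace_tateModuleMap_permAction_eq [Fintype G] (hb : ∑ s, b.π s ≫ b.ι s = 𝟙 b.pt)
    (hρ : ∀ (g : G) (s : S), b.ι s ≫ End.asHom (ρ g) = b.ι (g • s)) (hℓ : (ℓ : K) ≠ 0) :
    ∑ g, LinearMap.trace ℤ_[ℓ] (b.pt.tateModule ℓ) (tateModuleMap ℓ (End.asHom (ρ g))) =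
      ((Nat.card (Quotient (MulAction.orbitRel G S)) * Fintype.card G * (2 * A.dim) : ℕ) : ℤ_[ℓ]) := by
  classical
  simp_rw [trace_tateModuleMap_permAction_eq ℓ b ρ hb hρ hℓ]
  rw [← Nat.cast_sum, ← Finset.sum_mul]
  congr 2
  have hB := MulAction.sum_card_fixedBy_eq_card_orbits_mul_card_group G S
  rw [Nat.card_eq_fintype_card, ← hB]
  refine Finset.sum_congr rfl fun g _ ↦ ?_
  rw [Set.ncard_eq_toFinset_card', Set.toFinset_card]

end Character

/-! ## §3 Burnside's count: `dim B_G(A^S) = |G\S| · dim A`, `dim B_H(A^S) = |H\S| · dim A` -/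

section Burnside

variable {A : AbelianVariety K} {S : Type} [Fintype S] (b : Bicone (fun _ : S ↦ A))
  {G : Type} [Group G] [MulAction G S] (ρ : G →* End b.pt)

/-- **Burnside's count for the trivial-representation factor of a permutation power: `dim B_G(A^S) = |G\S| · dim A`**, where
`N_G = Σ_g ρ(g)` and `B_G = Im N_G` (`G` finite): `|G| · 2 dim B_G = Σ_g Tr(ρ(g) | T_ℓ A^S) = Σ_g |S^g| · 2 dim A = |G\S| · |G| · 2 dim A`
for an auxiliary prime `ℓ` invertible in `K`.  (`B_G` is the image of the orbit sums — a copy of `A^{S/G}` sitting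
"orbit-diagonally" in `A^S`.) [cite: SerreLinearRepresentations1977, §2.3 Ex. 2.6 (a) (`(χ|1) = c`)] [cite: LangeRodriguez2022, §2.9.1 Prop. 2.9.3 (PDF p. 46)]
[cite: KaniRosen1989, §3 Thm. B] [cite: DokchitserEtAl2022, §3 (additive functor lemma)] -/
theorem dim_image_normG_permAction_eq [Fintype G] (hb : ∑ s, b.π s ≫ b.ι s = 𝟙 b.pt)
    (hρ : ∀ (g : G) (s : S), b.ι s ≫ End.asHom (ρ g) = b.ι (g • s)) {NG : b.pt ⟶ b.pt} (hNG : End.of NG = ∑ g, ρ g) :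
    (image NG).dim = Nat.card (Quotient (MulAction.orbitRel G S)) * A.dim := by
  obtain ⟨ℓ, hℓp, hℓ⟩ := exists_prime_natCast_ne_zero (K := K)
  haveI : Fact ℓ.Prime := ⟨hℓp⟩
  have h := card_mul_two_mul_dim_image_normG_eq_sum_trace_tateModuleMap ℓ ρ hNG hℓ
  rw [sum_trace_tateModuleMap_permAction_eq ℓ b ρ hb hρ hℓ] at h
  have h' := Nat.cast_injective (R := ℤ_[ℓ]) h
  have hG : 0 < Fintype.card G := Fintype.card_pos
  have h'' : Fintype.card G * (2 * (image NG).dim) = Fintype.card G * (2 * (Nat.card (Quotient (MulAction.orbitRel G S)) * A.dim)) := by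
    rw [h']; ring
  have := Nat.eq_of_mul_eq_mul_left hG h''
  omega

/-- **`dim B_H(A^S) = |H\S| · dim A`** for a finite subgroup `H ≤ G` acting on the permutation power through `ρ`
(`N_H = Σ_{h ∈ H} ρ(h)`, `B_H = Im N_H`; the orbits are those of `H` on `S`).  For `S = G/L` this is the number of double
cosets `|H\G/L|`, symmetric in `H` and `L`. [cite: SerreLinearRepresentations1977, §2.3 Ex. 2.6 (a) and §7.3 Prop. 22]
[cite: LangeRodriguez2022, §2.9.1 Prop. 2.9.3 (PDF p. 46)] [cite: KaniRosen1989, §3 Thm. B] -/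
theorem dim_image_norm_permAction_eq {H : Subgroup G} [Fintype H] (hb : ∑ s, b.π s ≫ b.ι s = 𝟙 b.pt)
    (hρ : ∀ (g : G) (s : S), b.ι s ≫ End.asHom (ρ g) = b.ι (g • s)) {N : b.pt ⟶ b.pt} (hN : End.of N = ∑ h : H, ρ h) :
    (image N).dim = Nat.card (Quotient (MulAction.orbitRel H S)) * A.dim :=
  dim_image_normG_permAction_eq b (ρ.comp H.subtype) hb (fun h s ↦ hρ (h : G) s) hN

/-- **`dim B_G(A^S) = dim A` for a TRANSITIVE finite `G`-set `S`** (one orbit; e.g. the regular power `A^G`, where `B_G` is the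
diagonal, or a coset power `A^{G/L}`). [cite: SerreLinearRepresentations1977, §2.3 Ex. 2.6 (a) ("if G is transitive … ρ = 1 ⊕ θ")]
[cite: LangeRodriguez2022, §2.9.1 Prop. 2.9.3 (PDF p. 46)] -/
theorem dim_image_normG_permAction_eq_dim_of_isPretransitive [Fintype G] [Nonempty S] [MulAction.IsPretransitive G S]
    (hb : ∑ s, b.π s ≫ b.ι s = 𝟙 b.pt) (hρ : ∀ (g : G) (s : S), b.ι s ≫ End.asHom (ρ g) = b.ι (g • s))
    {NG : b.pt ⟶ b.pt} (hNG : End.of NG = ∑ g, ρ g) :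
    (image NG).dim = A.dim := by
  rw [dim_image_normG_permAction_eq b ρ hb hρ hNG]
  have h1 : Nat.card (Quotient (MulAction.orbitRel G S)) = 1 := by
    rw [Nat.card_eq_one_iff_unique]
    refine ⟨⟨fun x y ↦ ?_⟩, ⟨Quotient.mk _ (Classical.arbitrary S)⟩⟩
    induction x using Quotient.inductionOn with
    | h a =>
      induction y using Quotient.inductionOn with
      | h a' => exact Quotient.sound (MulAction.mem_orbit_iff.2 (MulAction.exists_smul_eq G a' a))
  rw [h1, one_mul]

/-- **`|G| · dim B_G(A^S) = |S| · dim A` for a FREE action** of the finite group `G` on `S` (every orbit has `|G|` elements,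
so `|G| · |G\S| = |S|`; the character vanishes off `1`, "regular type"). [cite: SerreLinearRepresentations1977, §2.3 Ex. 2.2 and Ex. 2.6 (a)]
[cite: KaniRosen1989, §3 Thm. B] -/
theorem card_mul_dim_image_normG_permAction_eq_of_free [Fintype G] (hb : ∑ s, b.π s ≫ b.ι s = 𝟙 b.pt)
    (hρ : ∀ (g : G) (s : S), b.ι s ≫ End.asHom (ρ g) = b.ι (g • s))
    (hfree : ∀ (g : G) (s : S), g • s = s → g = 1) {NG : b.pt ⟶ b.pt} (hNG : End.of NG = ∑ g, ρ g) :
    Fintype.card G * (image NG).dim = Fintype.card S * A.dim := by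
  classical
  rw [dim_image_normG_permAction_eq b ρ hb hρ hNG, ← mul_assoc]
  congr 1
  -- `|G| · |G\S| = |S|` for a free action: Burnside with `|S^1| = |S|`, `|S^g| = 0` for `g ≠ 1`
  have hB := MulAction.sum_card_fixedBy_eq_card_orbits_mul_card_group G S
  rw [Fintype.sum_eq_single (1 : G)] at hB
  · have h1 : Fintype.card (MulAction.fixedBy S (1 : G)) = Fintype.card S := by
      refine Fintype.card_of_subtype Finset.univ fun s ↦ ?_
      simp
    rw [h1] at hB
    rw [Nat.card_eq_fintype_card, mul_comm, hB]
  · intro g hg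
    rw [Fintype.card_eq_zero_iff]
    exact ⟨fun ⟨s, hs⟩ ↦ hg (hfree g s hs)⟩

end Burnside

/-! ## §4 Twisted (monomial) actions `ι_s ≫ ρ(g) = α(g) ≫ ι_{g s}`: `Tr(ρ(g) | T_ℓ A^S) = |S^g| · Tr(α(g) | T_ℓ A)` -/

section Twisted

variable (ℓ : ℕ) [Fact ℓ.Prime] {A : AbelianVariety K} {S : Type} [Fintype S] (b : Bicone (fun _ : S ↦ A))
  {G : Type} [Group G] [MulAction G S] (ρ : G →* End b.pt) (α : G →* End A)

/-- **The character of a twisted permutation action**: if `G` acts on `A^S` by `ι_s ≫ ρ(g) = α(g) ≫ ι_{g s}` for an action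
`α : G → End A` (the diagonal action on `A ⊗ ℤ[S]`; monomial matrices with entries `α(g)`), then
**`Tr(ρ(g) | T_ℓ A^S) = |S^g| · Tr(α(g) | T_ℓ A)`** (`ℓ` invertible in `K`): the diagonal blocks are `ι_s ≫ ρ(g) ≫ π_s = δ_{g s, s} α(g)`
— the character of a tensor product is the product of the characters. [cite: SerreLinearRepresentations1977, §2.3 Ex. 2.2 and §1.5 (character of a tensor product)]
[cite: MumfordAV1970, §19 Thm. 4 (p. 180)] -/
theorem trace_tateModuleMap_twistedPermAction_eq (hb : ∑ s, b.π s ≫ b.ι s = 𝟙 b.pt)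
    (hρ : ∀ (g : G) (s : S), b.ι s ≫ End.asHom (ρ g) = End.asHom (α g) ≫ b.ι (g • s)) (hℓ : (ℓ : K) ≠ 0) (g : G) :
    LinearMap.trace ℤ_[ℓ] (b.pt.tateModule ℓ) (tateModuleMap ℓ (End.asHom (ρ g))) =
      (MulAction.fixedBy S g).ncard * LinearMap.trace ℤ_[ℓ] (A.tateModule ℓ) (tateModuleMap ℓ (End.asHom (α g))) := by
  classical
  rw [trace_tateModuleMap_permPower_eq_sum ℓ b hb hℓ]
  have hdiag : ∀ s : S, LinearMap.trace ℤ_[ℓ] (A.tateModule ℓ) (tateModuleMap ℓ (b.ι s ≫ End.asHom (ρ g) ≫ b.π s)) =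
      if g • s = s then LinearMap.trace ℤ_[ℓ] (A.tateModule ℓ) (tateModuleMap ℓ (End.asHom (α g))) else 0 := fun s ↦ by
    rw [← Category.assoc, hρ g s, Category.assoc]
    by_cases h : g • s = s
    · rw [if_pos h]
      conv_lhs => rw [h, bicone_ι_π_self]
      erw [Category.comp_id]
    · rw [if_neg h, bicone_ι_π_ne b h, comp_zero, tateModuleMap_zero, map_zero]
  have hcard : (Finset.univ.filter fun s : S ↦ g • s = s).card = (MulAction.fixedBy S g).ncard := by
    rw [← Set.ncard_coe_finset]
    exact congrArg Set.ncard (Set.ext fun s ↦ by simp)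
  rw [Finset.sum_congr rfl fun s _ ↦ hdiag s, Finset.sum_ite, Finset.sum_const_zero, add_zero, Finset.sum_const,
    nsmul_eq_mul, hcard]

/-- **`|H| · 2 dim B_H = Σ_{h ∈ H} |S^h| · Tr(α(h) | T_ℓ A)`** for a twisted permutation action (`N_H = Σ_{h ∈ H} ρ(h)`,
`B_H = Im N_H`, `ℓ` invertible in `K`): `dim B_H = ½ ⟨χ_S · χ_ℓ^α, 1⟩_H`, the multiplicity count for the tensor product of the
permutation representation with `T_ℓ A`. [cite: SerreLinearRepresentations1977, §2.3 Ex. 2.6 (a) and §1.5] [cite: LangeRodriguez2022, §2.9.1 Prop. 2.9.3 (PDF p. 46)]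
[cite: DokchitserEtAl2022, §3 (additive functor lemma)] -/
theorem card_mul_two_mul_dim_image_norm_twistedPermAction_eq_sum {H : Subgroup G} [Fintype H]
    (hb : ∑ s, b.π s ≫ b.ι s = 𝟙 b.pt)
    (hρ : ∀ (g : G) (s : S), b.ι s ≫ End.asHom (ρ g) = End.asHom (α g) ≫ b.ι (g • s)) (hℓ : (ℓ : K) ≠ 0)
    {N : b.pt ⟶ b.pt} (hN : End.of N = ∑ h : H, ρ h) :
    ((Fintype.card H * (2 * (image N).dim) : ℕ) : ℤ_[ℓ]) =
      ∑ h : H, (MulAction.fixedBy S (h : G)).ncard *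
        LinearMap.trace ℤ_[ℓ] (A.tateModule ℓ) (tateModuleMap ℓ (End.asHom (α h))) := by
  rw [card_mul_two_mul_dim_image_norm_eq_sum_trace_tateModuleMap ℓ ρ hN hℓ]
  exact Finset.sum_congr rfl fun h _ ↦ trace_tateModuleMap_twistedPermAction_eq ℓ b ρ α hb hρ hℓ (h : G)

end Twisted

end AbelianVariety

end Literature.AlgebraicGeometry.Motives
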